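import Literature.NumberTheory.Automorphic.UnitaryGroupStableOrbitalIntegral
import Literature.MeasureTheory.Group.InvariantQuotientNormalized
import HarnessLib

/-!
# The trace functional of the anisotropic inner form with the PRINTED volumes:
# `θ_{G′}(F) = Σ_{[γ]} vol(U(H)(L⁺)_γ \ U(H)(𝔸)_γ) · ∫_{U(H)(𝔸)_γ \ U(H)(𝔸)} F(y γ y⁻¹) d(ν/ν_γ)(y)`
# — the orbital weights ARE covolumes
(Rogawski, *Automorphic representations of unitary groups in three variables* (1990), §14.5 pp. 237–238 (print):
`J_{G′}(f′) = Σ_γ a_γ Φ(γ, f′)` with `a_γ = m(G′_γ \ G′_γ(𝔸))` up to the stable bookkeeping; Gelbart (1975), (9.13) and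
Remark 9.23: `tr R(f) = Σ_{[γ]} vol(Γ(γ)\G(γ)) ∫_{G(γ)\G} f(x⁻¹ γ x) dx`)

Topic `NumberTheory/Automorphic`; namespaces `Literature.NumberTheory.Automorphic.AdelicGroupData` (§1, any adelic group datum
with `A_G = ⊥`, discrete `G(K)` and compact automorphic quotient) and `….UnitaryGroup` (§2–§3, `U(H)` of an ANISOTROPIC hermitian
matrix over a CM field).  THEOREMS ONLY (no definition, no instance, no named fact, no `sorry`); imports = tree.

WHY.  The tree's orbital expansion of the trace functional of the inner form (★ `UnitaryGroupGeometricSide`,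
★ `UnitaryGroupDiagTraceExpansion`, ★ `UnitaryGroupOrbitalTerms(Currency|Anisotropic)`) carries the CAVEAT «`κ`, `c`, `d_c`, `μ_c`
not normalised»: against ANY admissible family `μ` of adelic orbital measures the genuine orbital terms are `a[γ] · Φ_μ(γ, F)` with
OPAQUE weights `a[γ] > 0` (★ `exists_weight_diagTrace_eq_finsum_orbitalSum_of_admissible`, uniqueness of invariant measures).
The stabilisation of the geometric side (T1b of the floor-0 line `F0_T1InnerFormTraceIdentity`; Rogawski §14.5 p. 238,
`a_γ = ε_st(γ₀)⁻¹ m(Z𝐆_γ \ 𝐆_γ(𝔸))`) needs the PRINTED weights: for the family of QUOTIENT measures `ν/ν_γ` (Weil constant one,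
★ `InvariantQuotientNormalized`) built from a Haar measure `ν` on `U(H)(𝔸)` and Haar measures `ν_γ` on the adelic centralisers
`U(H)(𝔸)_γ`, the weight of the class `[γ]` is the COVOLUME `vol(U(H)(L⁺)_γ \ U(H)(𝔸)_γ)` of the discrete group `U(H)(L⁺)_γ`
(counting measure) in `U(H)(𝔸)_γ` (measure `ν_γ`) — no constant left over: the normalisations of `μ` (automorphic) and of the
counting measure cancel inside `θ = c⁻¹ ∫_X K_F(x, x) dμ`, those of the `ν_γ` cancel between covolume and orbital integral, and
both sides depend on `ν` alone.  This is the `U(H)`-twin of ★ `QuaternionUnitsTraceNormalized` (Gelbart Remark 9.23 ∕ (10.14) for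
`D^×`), assembled from the same generic bricks (★ `Literature.MeasureTheory.Group.lintegral_conjTsum_eq_mul_tsum_covol_mul`,
★ `AdelicGroupData.integral_quotientKernel_diag_eq_mul_tsum`) and the per-class inputs of ★ `UnitaryGroupTraceClasses`.

* §1 (generic, `AdelicGroupData`, `A_G = ⊥`, discrete `G(K)`, compact `X = G(𝔸) ⧸ G(K)`; classes indexed by any type `I` along a
  bijection `e : I ≃ ConjClasses G(K)` with representatives `rep i ∈ G(K)`, `[rep i] = e i`):
  `isHaarMeasure_count_inf_subgroupOf` (counting measure is a Haar measure on the discrete `G(K)_γ = G(K) ∩ G_γ ≤ G_γ`);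
  `finite_support_mul_integral_descConj` (for `Φ ∈ C_c`, `i ↦ w_i ∫ Φ(y (rep i) y⁻¹) dm_i` is finitely supported for ANY weights and
  measures, ★ `finite_conjClasses_meeting_isCompact`);
  **`integral_quotientKernel_diag_eq_mul_tsum_covol_mul_of_center'_eq_bot`** — automorphic `μ`, Haar `ν`, Haar measures `ν_i` on
  `G_i = C_{G(𝔸)}(rep i)` (two-sided, inversion invariant): for every `Φ ∈ C_c(G(𝔸))` the orbital integrands are integrable for
  `ν/ν_i`, `Σ_i vol(G(K)_i \ G_i) ∫ |Φ(y (rep i) y⁻¹)| d(ν/ν_i) < ∞`, and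
  `∫_X K^{count}_Φ(x, x) dμ = c_μ · Σ'_i vol(G(K)_i \ G_i) · ∫_{G(𝔸) ⧸ G_i} Φ(y (rep i) y⁻¹) d(ν/ν_i)(y)`,
  `c_μ = unfoldingConstant G(K) count μ ν`, `vol(G(K)_i \ G_i)` the total mass of `quotientMeasure (G(K)_i ≤ G_i) count ν_i`;
  `covol_ne_zero_ne_top` (the covolumes lie in `(0, ∞)`); **`diagTrace_eq_tsum_covol_mul_of_center'_eq_bot`** —
  `θ(Φ) = c_μ⁻¹ ∫_X K_Φ(x,x) dμ = Σ'_i vol(G(K)_i \ G_i) · O_i(Φ)`: NO constant.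
* §2 (`UnitaryGroup`, `H` anisotropic — the instance binders of §3 are dischargeable; closedness of the adelic centralisers is
  Mathlib's `Set.isClosed_centralizer`): `exists_conjClasses_equiv_toAdelic_out` (the bijection `[γ] ↦ [toAdelic γ]` with representatives `toAdelic (out [γ])`);
  `isInvInvariant_centralizer_cmDatum` (every Haar measure on `U(H)(𝔸)_γ` is two-sided ★ `isMulRightInvariant_centralizer_cmDatum`,
  hence inversion invariant); `isHaarMeasure_count_inf_centralizer_subgroupOf_cmDatum` (`U(H)(L⁺) ∩ U(H)(𝔸)_γ` is discrete and
  countable, so the counting measure is a Haar measure on it).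
* §3 **`UnitaryGroup.diagTrace_eq_tsum_covol_mul_orbitalIntegral`** — `θ_{G′}(F) = Σ'_{[γ]} vol(U(H)(L⁺)_γ \ U(H)(𝔸)_γ) ·
  Φ_{ν/ν_γ}(γ, F)` over the conjugacy classes `[γ]` of the RATIONAL group `U(H)(L⁺)` at the representatives `toAdelic (out [γ])`
  (the index type and representatives of ★ `adelicClassOrbitalIntegral`), absolutely convergent; `covol_toReal_pos_cmDatum` (the
  covolumes are positive reals); **`diagTrace_eq_finsum_covol_mul_adelicClassOrbitalIntegral`** — the same as a `finsum` with finite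
  support, in the currency ★ `adelicClassOrbitalIntegral L N H μ F [γ]` for the family `μ[γ] := ν/ν_γ` (an ★ `AdelicOrbitalMeasureFamily`);
  **`diagTrace_eq_finsum_stableClass_orbitalSum_covol_mul`** — T1a with the printed weights:
  `θ_{G′}(F) = Σᶠ_{𝒪_st} 𝒪_st.orbitalSum ([γ] ↦ vol(U(H)(L⁺)_γ \ U(H)(𝔸)_γ) · Φ_{ν/ν_γ}(γ, F))` (★ `finsum_stableClass_orbitalSum`)
  — i.e. in ★ `exists_weight_diagTrace_eq_finsum_orbitalSum_of_admissible` the weights CAN BE CHOSEN `a[γ] = covolume > 0` when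
  the family is `ν/ν_γ`.

Deliberately NOT here: the identification of the covolumes with Tamagawa numbers ∕ `ε_st`, the comparison of `ν_γ`, `ν_{γ′}` for
stably conjugate `γ, γ′` (measure coherence along `Z(γ) ≃ Z(γ′)`, ★ `quotientMeasure_univ_eq_of_mulEquiv`), singular classes'
special treatment (none is needed: every rational class of the anisotropic `U(H)` is covered).

## References
* J. D. Rogawski, *Automorphic Representations of Unitary Groups in Three Variables*, Ann. of Math. Stud. 123 (1990), §14.5
  pp. 237–238 (print) [Rogawski1990].
* S. Gelbart, *Automorphic forms on adele groups*, Ann. of Math. Stud. 83 (1975), (9.11)–(9.13) (p. 118), Remark 9.23 (p. 140)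
  [Gelbart1975].
* A. Deitmar, S. Echterhoff, *Principles of Harmonic Analysis*, 2nd ed. (2014), Thm. 1.5.3, Thm. 9.3.2, Lemma 9.3.3
  [DeitmarEchterhoff2014].
-/

noncomputable section

open MeasureTheory Measure Set Filter Topology NumberField CompactlySupported
open Literature.MeasureTheory.Group
open scoped ENNReal NNReal Pointwise

namespace Literature.NumberTheory.Automorphic

universe u

/-! ## §1 Adelic group data with trivial split centre: the geometric side with the printed volumes -/

namespace AdelicGroupData

variable {K : Type} [Field K] [NumberField K] (𝒢 : AdelicGroupData.{u} K)

attribute [local instance] measurableSpaceQuotientForm borelSpaceQuotientForm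
  smulInvariantMeasureQuotientForm isFiniteMeasureOnCompactsQuotientForm isFiniteMeasureQuotientForm

variable [LocallyCompactSpace 𝒢.Adelic] [SecondCountableTopology 𝒢.Adelic] [T2Space 𝒢.Adelic]
  [MeasurableSpace 𝒢.Adelic] [BorelSpace 𝒢.Adelic]

omit [LocallyCompactSpace 𝒢.Adelic] [SecondCountableTopology 𝒢.Adelic] [T2Space 𝒢.Adelic]
  [MeasurableSpace 𝒢.Adelic] [BorelSpace 𝒢.Adelic] in
/-- For `A_G = ⊥`: `A_G · G(K) = G(K)`. [folklore] -/
private theorem quotientSubgroup_eq_of_center'_eq_bot (hc : 𝒢.center' = ⊥) :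
    𝒢.quotientSubgroup = 𝒢.arithmeticSubgroup := by
  rw [quotientSubgroup, hc, bot_sup_eq]

omit [LocallyCompactSpace 𝒢.Adelic] [SecondCountableTopology 𝒢.Adelic] [T2Space 𝒢.Adelic]
  [MeasurableSpace 𝒢.Adelic] [BorelSpace 𝒢.Adelic] in
/-- For `A_G = ⊥` and discrete `G(K)`: `A_G · G(K)` is discrete. [folklore] -/
private theorem discreteTopology_quotientSubgroup' (hc : 𝒢.center' = ⊥) (hdisc : 𝒢.IsDiscreteRational) :
    DiscreteTopology 𝒢.quotientSubgroup := by
  rw [𝒢.quotientSubgroup_eq_of_center'_eq_bot hc]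
  exact hdisc

omit [LocallyCompactSpace 𝒢.Adelic] [SecondCountableTopology 𝒢.Adelic] [T2Space 𝒢.Adelic]
  [MeasurableSpace 𝒢.Adelic] [BorelSpace 𝒢.Adelic] in
/-- A subgroup `M ⊓ A_G·G(K)`-type subtype mapping continuously and injectively into the discrete `A_G · G(K)` is discrete:
`(A_G·G(K) ⊓ C)` as a subgroup of `G(𝔸)`. [folklore] -/
private theorem discreteTopology_inf [DiscreteTopology 𝒢.quotientSubgroup] (C : Subgroup 𝒢.Adelic) :
    DiscreteTopology ↥(𝒢.quotientSubgroup ⊓ C) :=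
  DiscreteTopology.of_continuous_injective
    (f := fun x : ↥(𝒢.quotientSubgroup ⊓ C) => (⟨(x : 𝒢.Adelic), (Subgroup.mem_inf.1 x.2).1⟩ : 𝒢.quotientSubgroup))
    (continuous_subtype_val.subtype_mk _) fun _ _ hab => Subtype.ext (congrArg (fun y : 𝒢.quotientSubgroup => (y : 𝒢.Adelic)) hab)

omit [LocallyCompactSpace 𝒢.Adelic] [SecondCountableTopology 𝒢.Adelic] [T2Space 𝒢.Adelic]
  [MeasurableSpace 𝒢.Adelic] [BorelSpace 𝒢.Adelic] in
/-- … and so is `(A_G·G(K) ⊓ C).subgroupOf C` as a subgroup of `C`. [folklore] -/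
private theorem discreteTopology_inf_subgroupOf [DiscreteTopology 𝒢.quotientSubgroup] (C : Subgroup 𝒢.Adelic) :
    DiscreteTopology ↥((𝒢.quotientSubgroup ⊓ C).subgroupOf C) :=
  DiscreteTopology.of_continuous_injective
    (f := fun x : ↥((𝒢.quotientSubgroup ⊓ C).subgroupOf C) =>
      (⟨((x : C) : 𝒢.Adelic), (Subgroup.mem_inf.1 (Subgroup.mem_subgroupOf.1 x.2)).1⟩ : 𝒢.quotientSubgroup))
    ((continuous_subtype_val.comp continuous_subtype_val).subtype_mk _) fun _ _ hab =>
      Subtype.ext (Subtype.ext (congrArg (fun y : 𝒢.quotientSubgroup => (y : 𝒢.Adelic)) hab))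

omit [LocallyCompactSpace 𝒢.Adelic] [SecondCountableTopology 𝒢.Adelic] in
/-- **Counting measure is a Haar measure on `G(K)_γ = A_G·G(K) ∩ C` viewed inside the centraliser `C`**, for `A_G · G(K)`
discrete and countable — the measure on the discrete `Γ(γ)` implicit in the printed covolume `vol(Γ(γ) \ G(γ))` of Gelbart's
Remark 9.23 ∕ (9.13). [cite: Gelbart1975, Remark 9.23] -/
theorem isHaarMeasure_count_inf_subgroupOf [DiscreteTopology 𝒢.quotientSubgroup] [Countable 𝒢.quotientSubgroup]
    (C : Subgroup 𝒢.Adelic) :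
    (count : Measure ↥((𝒢.quotientSubgroup ⊓ C).subgroupOf C)).IsHaarMeasure := by
  haveI := 𝒢.discreteTopology_inf_subgroupOf C
  haveI : Countable ↥((𝒢.quotientSubgroup ⊓ C).subgroupOf C) := by
    refine Function.Injective.countable (f := fun x : ↥((𝒢.quotientSubgroup ⊓ C).subgroupOf C) =>
      (⟨((x : C) : 𝒢.Adelic), (Subgroup.mem_inf.1 (Subgroup.mem_subgroupOf.1 x.2)).1⟩ : 𝒢.quotientSubgroup)) ?_
    intro a b hab
    exact Subtype.ext (Subtype.ext (congrArg (fun y : 𝒢.quotientSubgroup => (y : 𝒢.Adelic)) hab))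
  exact isHaarMeasure_count_of_discrete

omit [LocallyCompactSpace 𝒢.Adelic] [SecondCountableTopology 𝒢.Adelic] in
/-- Counting measure is a Haar measure on `A_G·G(K) ∩ C ≤ G(𝔸)` (discrete, countable). [folklore] -/
private theorem isHaarMeasure_count_inf [DiscreteTopology 𝒢.quotientSubgroup] [Countable 𝒢.quotientSubgroup]
    (C : Subgroup 𝒢.Adelic) :
    (count : Measure ↥(𝒢.quotientSubgroup ⊓ C)).IsHaarMeasure := by
  haveI := 𝒢.discreteTopology_inf C
  haveI : Countable ↥(𝒢.quotientSubgroup ⊓ C) := by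
    refine Function.Injective.countable (f := fun x : ↥(𝒢.quotientSubgroup ⊓ C) =>
      (⟨(x : 𝒢.Adelic), (Subgroup.mem_inf.1 x.2).1⟩ : 𝒢.quotientSubgroup)) ?_
    intro a b hab
    exact Subtype.ext (congrArg (fun y : 𝒢.quotientSubgroup => (y : 𝒢.Adelic)) hab)
  exact isHaarMeasure_count_of_discrete

omit [LocallyCompactSpace 𝒢.Adelic] [SecondCountableTopology 𝒢.Adelic] [BorelSpace 𝒢.Adelic] in
/-- **Counting measures restrict to counting measures**: on a countable type with measurable singletons, the pull-back of
`count` along an injective map is `count`. [folklore] -/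
private theorem comap_count_eq_count {α β : Type*} [MeasurableSpace α] [MeasurableSpace β] [Countable α] [Countable β]
    [MeasurableSingletonClass α] [MeasurableSingletonClass β] {f : α → β} (hf : Function.Injective f) :
    (count : Measure β).comap f = count := by
  refine Measure.ext_of_singleton fun a => ?_
  rw [Measure.comap_apply f hf (fun s _ => (Set.to_countable _).measurableSet) _ (measurableSet_singleton a),
    Set.image_singleton, count_singleton, count_singleton]

omit [LocallyCompactSpace 𝒢.Adelic] [SecondCountableTopology 𝒢.Adelic] [BorelSpace 𝒢.Adelic] in
/-- … and the push-forward of `count` along a measurable bijection is `count`. [folklore] -/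
private theorem map_count_eq_count {α β : Type*} [MeasurableSpace α] [MeasurableSpace β] [Countable α] [Countable β]
    [MeasurableSingletonClass α] [MeasurableSingletonClass β] (e : α ≃ β) (he : Measurable e) :
    (count : Measure α).map e = count := by
  refine Measure.ext_of_singleton fun b => ?_
  rw [Measure.map_apply he (measurableSet_singleton b), count_singleton]
  have : (e : α → β) ⁻¹' {b} = {e.symm b} := by
    ext a
    simp only [Set.mem_preimage, Set.mem_singleton_iff, Equiv.apply_eq_iff_eq_symm_apply]
  rw [this, count_singleton]

omit [SecondCountableTopology 𝒢.Adelic] [MeasurableSpace 𝒢.Adelic] [BorelSpace 𝒢.Adelic] in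
/-- **Only finitely many classes contribute**, for ANY weights and ANY orbital measures: if `G(K)` is discrete and the automorphic
quotient compact, then for `Φ ∈ C_c(G(𝔸_K))` and representatives `rep i ∈ G(K)` of the conjugacy classes of `G(K)` (indexed by any
type `I` along a bijection `e : I ≃ ConjClasses G(K)`), the class function `i ↦ w_i · ∫ Φ(y (rep i) y⁻¹) dm_i(y)` is finitely
supported (★ `finite_conjClasses_meeting_isCompact`: off the finitely many classes meeting `tsupport Φ` the integrand vanishes
identically). [cite: Gelbart1975, Remark 9.23] -/
theorem finite_support_mul_integral_descConj (hdisc : 𝒢.IsDiscreteRational) [CompactSpace 𝒢.automorphicQuotient]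
    {I : Type*} (e : I ≃ ConjClasses 𝒢.arithmeticSubgroup) (rep : I → 𝒢.Adelic) (hmem : ∀ i, rep i ∈ 𝒢.arithmeticSubgroup)
    (hrep : ∀ i, ConjClasses.mk (⟨rep i, hmem i⟩ : 𝒢.arithmeticSubgroup) = e i)
    [∀ γ : 𝒢.Adelic, MeasurableSpace (𝒢.Adelic ⧸ Subgroup.centralizer ({γ} : Set 𝒢.Adelic))]
    (m : ∀ i, Measure (𝒢.Adelic ⧸ Subgroup.centralizer ({rep i} : Set 𝒢.Adelic))) (w : I → ℂ) (Φ : C_c(𝒢.Adelic, ℂ)) :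
    (Function.support fun i => w i * ∫ y, descConj (rep i) (Subgroup.centralizer ({rep i} : Set 𝒢.Adelic))
        (fun _ hg => Subgroup.mem_centralizer_singleton_iff.1 hg) Φ y ∂(m i)).Finite := by
  have hfin := 𝒢.finite_conjClasses_meeting_isCompact hdisc Φ.hasCompactSupport
  refine (hfin.preimage e.injective.injOn).subset fun i hi => ?_
  rw [Function.mem_support] at hi
  refine ⟨⟨rep i, hmem i⟩, hrep i, ?_⟩
  by_contra hno
  apply hi
  have hzero : descConj (rep i) (Subgroup.centralizer ({rep i} : Set 𝒢.Adelic))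
      (fun _ hg => Subgroup.mem_centralizer_singleton_iff.1 hg) (⇑Φ) = fun _ => 0 := by
    funext y
    induction y using QuotientGroup.induction_on with
    | H g =>
      show Φ (g * rep i * g⁻¹) = 0
      exact image_eq_zero_of_notMem_tsupport fun hg => hno ⟨g, hg⟩
  rw [hzero, integral_zero, mul_zero]

/-- **The geometric side with the printed volumes, for a datum with trivial split centre and compact automorphic quotient**
(Gelbart (1975), (9.13): `tr R(f) = Σ_{[γ]} vol(Γ(γ)\G(γ)) ∫_{G(γ)\G} f(x⁻¹ γ x) dx`; Deitmar–Echterhoff (2014), Thm. 9.3.2).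
Setting: `𝒢` with `A_G = ⊥`, `G(𝔸_K)` locally compact second countable Hausdorff, `G(K)` discrete, `X = G(𝔸_K) ⧸ G(K)` compact,
`μ` automorphic, `ν` a Haar measure on `G(𝔸_K)` (two-sided — true here, ★ `isMulRightInvariant_of_center'_eq_bot`); representatives
`rep i ∈ G(K)` of the conjugacy classes of `G(K)`, indexed by any type `I` along a bijection `e : I ≃ ConjClasses G(K)`
(`[rep i] = e i`); Haar measures `ν_i` on the centralisers `G_i = C_{G(𝔸)}(rep i)` (two-sided and inversion invariant — true here,
★ `isMulRightInvariant_centralizer_of_center'_eq_bot`); the counting measure on the discrete `G(K)_i = G(K) ∩ G_i` (a Haar measure,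
`isHaarMeasure_count_inf_subgroupOf`).  Then for every `Φ ∈ C_c(G(𝔸_K))`: every orbital integrand `y ↦ Φ(y (rep i) y⁻¹)` is
integrable for the quotient measure `ν/ν_i = quotientMeasure G_i ν_i ν` (Weil constant one),
`Σ_i vol(G(K)_i \ G_i) ∫ |Φ(y (rep i) y⁻¹)| d(ν/ν_i) < ∞`, and

  `∫_X K_Φ(x, x) dμ = c_μ · Σ'_i vol(G(K)_i \ G_i) · ∫_{G(𝔸) ⧸ G_i} Φ(y (rep i) y⁻¹) d(ν/ν_i)(y)`,

with `K_Φ` the kernel for the COUNTING measure on `G(K)`, `c_μ = unfoldingConstant G(K) count μ ν` (Weil's constant of `μ`) and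
`vol(G(K)_i \ G_i) = quotientMeasure (G(K)_i ≤ G_i) count ν_i (univ)` the covolume.  (★ `lintegral_conjTsum_eq_mul_tsum_covol_mul`
with the per-class inputs of ★ `UnitaryGroupTraceClasses`, passed to `ℂ` by ★ `integral_quotientKernel_diag_eq_mul_tsum`; the
kernel's constant `κ` is `1` for the counting measure.) [cite: Gelbart1975, (9.13) and Remark 9.23] -/
theorem integral_quotientKernel_diag_eq_mul_tsum_covol_mul_of_center'_eq_bot (hc : 𝒢.center' = ⊥)
    (hdisc : 𝒢.IsDiscreteRational) [CompactSpace 𝒢.automorphicQuotient]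
    [hH : IsClosed (𝒢.quotientSubgroup : Set 𝒢.Adelic)]
    [hCcl : ∀ γ : 𝒢.Adelic, IsClosed ((Subgroup.centralizer ({γ} : Set 𝒢.Adelic) : Subgroup 𝒢.Adelic) : Set 𝒢.Adelic)]
    [IsFiniteMeasureOnCompacts (count : Measure 𝒢.quotientSubgroup)]
    [∀ γ : 𝒢.Adelic, MeasurableSpace (𝒢.Adelic ⧸ Subgroup.centralizer ({γ} : Set 𝒢.Adelic))]
    [∀ γ : 𝒢.Adelic, BorelSpace (𝒢.Adelic ⧸ Subgroup.centralizer ({γ} : Set 𝒢.Adelic))]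
    [∀ γ : 𝒢.Adelic, MeasurableSpace (↥(Subgroup.centralizer ({γ} : Set 𝒢.Adelic)) ⧸
      (𝒢.quotientSubgroup ⊓ Subgroup.centralizer ({γ} : Set 𝒢.Adelic)).subgroupOf (Subgroup.centralizer ({γ} : Set 𝒢.Adelic)))]
    [∀ γ : 𝒢.Adelic, BorelSpace (↥(Subgroup.centralizer ({γ} : Set 𝒢.Adelic)) ⧸
      (𝒢.quotientSubgroup ⊓ Subgroup.centralizer ({γ} : Set 𝒢.Adelic)).subgroupOf (Subgroup.centralizer ({γ} : Set 𝒢.Adelic)))]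
    [∀ γ : 𝒢.Adelic, (count : Measure ↥((𝒢.quotientSubgroup ⊓ Subgroup.centralizer ({γ} : Set 𝒢.Adelic)).subgroupOf
      (Subgroup.centralizer ({γ} : Set 𝒢.Adelic)))).IsHaarMeasure]
    (μ : Measure 𝒢.automorphicQuotient) [𝒢.IsAutomorphicMeasure μ]
    (ν : Measure 𝒢.Adelic) [IsHaarMeasure ν] [ν.IsMulRightInvariant]
    {I : Type*} (e : I ≃ ConjClasses 𝒢.arithmeticSubgroup) (rep : I → 𝒢.Adelic) (hmem : ∀ i, rep i ∈ 𝒢.arithmeticSubgroup)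
    (hrep : ∀ i, ConjClasses.mk (⟨rep i, hmem i⟩ : 𝒢.arithmeticSubgroup) = e i)
    (νC : ∀ i, Measure ↥(Subgroup.centralizer ({rep i} : Set 𝒢.Adelic))) [∀ i, IsHaarMeasure (νC i)]
    [∀ i, (νC i).IsMulRightInvariant] [∀ i, (νC i).IsInvInvariant] (Φ : C_c(𝒢.Adelic, ℂ)) :
    (∀ i, Integrable (descConj (rep i) (Subgroup.centralizer ({rep i} : Set 𝒢.Adelic))
        (fun _ hg => Subgroup.mem_centralizer_singleton_iff.1 hg) Φ)
        (quotientMeasure (Subgroup.centralizer ({rep i} : Set 𝒢.Adelic)) (νC i) (hCcl _) ν)) ∧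
    Summable (fun i => (quotientMeasure ((𝒢.quotientSubgroup ⊓ Subgroup.centralizer ({rep i} : Set 𝒢.Adelic)).subgroupOf
          (Subgroup.centralizer ({rep i} : Set 𝒢.Adelic))) count (isClosed_subgroupOf _ _ (hH.inter (hCcl _))) (νC i)
          Set.univ).toReal *
        ∫ y, ‖descConj (rep i) (Subgroup.centralizer ({rep i} : Set 𝒢.Adelic))
          (fun _ hg => Subgroup.mem_centralizer_singleton_iff.1 hg) Φ y‖
          ∂(quotientMeasure (Subgroup.centralizer ({rep i} : Set 𝒢.Adelic)) (νC i) (hCcl _) ν)) ∧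
    ∫ x, quotientKernel 𝒢.quotientSubgroup (count : Measure 𝒢.quotientSubgroup) Φ x x ∂μ =
      ((unfoldingConstant 𝒢.quotientSubgroup (count : Measure 𝒢.quotientSubgroup) μ ν : ℝ) : ℂ) *
        ∑' i, (((quotientMeasure ((𝒢.quotientSubgroup ⊓ Subgroup.centralizer ({rep i} : Set 𝒢.Adelic)).subgroupOf
            (Subgroup.centralizer ({rep i} : Set 𝒢.Adelic))) count (isClosed_subgroupOf _ _ (hH.inter (hCcl _))) (νC i)
            Set.univ).toReal : ℝ) : ℂ) *
          ∫ y, descConj (rep i) (Subgroup.centralizer ({rep i} : Set 𝒢.Adelic))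
            (fun _ hg => Subgroup.mem_centralizer_singleton_iff.1 hg) Φ y
            ∂(quotientMeasure (Subgroup.centralizer ({rep i} : Set 𝒢.Adelic)) (νC i) (hCcl _) ν) := by
  classical
  haveI : DiscreteTopology 𝒢.arithmeticSubgroup := hdisc
  haveI : DiscreteTopology 𝒢.quotientSubgroup := 𝒢.discreteTopology_quotientSubgroup' hc hdisc
  haveI : Countable 𝒢.quotientSubgroup := TopologicalSpace.separableSpace_iff_countable.1 inferInstance
  haveI : Countable 𝒢.arithmeticSubgroup := TopologicalSpace.separableSpace_iff_countable.1 inferInstance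
  -- the trivial central retraction `θ = 1`
  have hθc : Continuous (1 : 𝒢.Adelic →* 𝒢.Adelic) := continuous_const
  have hθA : ∀ g, (1 : 𝒢.Adelic →* 𝒢.Adelic) g ∈ 𝒢.center' := fun g => by
    rw [MonoidHom.one_apply]; exact one_mem _
  have hθa : ∀ a ∈ 𝒢.center', (1 : 𝒢.Adelic →* 𝒢.Adelic) a = a := fun a ha => by
    rw [hc, Subgroup.mem_bot] at ha
    rw [ha, MonoidHom.one_apply]
  have hθγ : ∀ γ ∈ 𝒢.arithmeticSubgroup, (1 : 𝒢.Adelic →* 𝒢.Adelic) γ = 1 := fun _ _ => rfl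
  -- `A_G = 1` is a point; its probability Haar measure `α`, for which `Φ_A = Φ`
  have hsub : ∀ a : 𝒢.center', (a : 𝒢.Adelic) = 1 := fun a =>
    Subgroup.mem_bot.1 (by rw [← hc]; exact a.2)
  haveI : Subsingleton 𝒢.center' := ⟨fun a b => Subtype.ext ((hsub a).trans (hsub b).symm)⟩
  haveI : CompactSpace 𝒢.center' := Finite.compactSpace
  have hAc : IsClosed (𝒢.center' : Set 𝒢.Adelic) := by
    rw [hc, Subgroup.coe_bot]
    exact isClosed_singleton
  haveI : LocallyCompactSpace 𝒢.center' := hAc.isClosedEmbedding_subtypeVal.locallyCompactSpace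
  obtain ⟨α, hαH, hα1⟩ : ∃ α : Measure 𝒢.center', α.IsHaarMeasure ∧ α Set.univ = 1 := by
    have h0 : (haar : Measure 𝒢.center') Set.univ ≠ 0 :=
      (isOpen_univ.measure_pos haar ⟨1, trivial⟩).ne'
    have htop : (haar : Measure 𝒢.center') Set.univ ≠ ∞ :=
      (isCompact_univ.measure_lt_top (μ := (haar : Measure 𝒢.center'))).ne
    refine ⟨((haar : Measure 𝒢.center') Set.univ)⁻¹ • haar,
      IsHaarMeasure.smul (haar : Measure 𝒢.center') (ENNReal.inv_ne_zero.2 htop)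
        (ENNReal.inv_ne_top.2 h0), ?_⟩
    rw [Measure.smul_apply, smul_eq_mul, ENNReal.inv_mul_cancel h0 htop]
  haveI := hαH
  haveI : IsFiniteMeasure α := ⟨by rw [hα1]; exact ENNReal.one_lt_top⟩
  have hΦA : (fun g => ∫ a, Φ ((a : 𝒢.Adelic)⁻¹ * g) ∂α) = ⇑Φ := by
    funext g
    have h1 : (fun a : 𝒢.center' => Φ ((a : 𝒢.Adelic)⁻¹ * g)) = fun _ => Φ g := by
      funext a
      rw [hsub a, inv_one, one_mul]
    rw [h1, integral_const]
    simp [measureReal_def, hα1]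
  -- the counting measure on `G(K)` is `1 • (α ⊗ count)` pushed forward along `(a, γ) ↦ a γ`
  haveI : (count : Measure 𝒢.quotientSubgroup).IsHaarMeasure := isHaarMeasure_count_of_discrete
  have hme := measurableEmbedding_mulMap 𝒢 1 hθc hθA hθa hθγ
  have hκ : (count : Measure 𝒢.quotientSubgroup) = (1 : ℝ≥0) • Measure.map
      (fun p : 𝒢.center' × 𝒢.arithmeticSubgroup => (⟨(p.1 : 𝒢.Adelic) * p.2, mulMap_mem 𝒢 p⟩ : 𝒢.quotientSubgroup))
      (α.prod count) := by
    rw [one_smul]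
    refine Measure.ext_of_singleton fun h => ?_
    have hmemh : (h : 𝒢.Adelic) ∈ 𝒢.arithmeticSubgroup := by
      rw [← 𝒢.quotientSubgroup_eq_of_center'_eq_bot hc]; exact h.2
    have hpre : (fun p : 𝒢.center' × 𝒢.arithmeticSubgroup =>
        (⟨(p.1 : 𝒢.Adelic) * p.2, mulMap_mem 𝒢 p⟩ : 𝒢.quotientSubgroup)) ⁻¹' {h} =
        (Set.univ : Set 𝒢.center') ×ˢ ({⟨(h : 𝒢.Adelic), hmemh⟩} : Set 𝒢.arithmeticSubgroup) := by
      ext p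
      simp only [Set.mem_preimage, Set.mem_singleton_iff, Set.mem_prod, Set.mem_univ, true_and]
      constructor
      · intro hp
        apply Subtype.ext
        have := congrArg (fun y : 𝒢.quotientSubgroup => (y : 𝒢.Adelic)) hp
        simpa only [hsub p.1, one_mul] using this
      · intro hp
        apply Subtype.ext
        show (p.1 : 𝒢.Adelic) * p.2 = h
        rw [hp, hsub p.1, one_mul]
    rw [count_singleton, Measure.map_apply hme.measurable (measurableSet_singleton h), hpre,
      Measure.prod_prod, hα1, count_singleton, one_mul]
  -- per-class data, indexed by `i : I`
  have hΓsub : ∀ i, 𝒢.quotientSubgroup ⊓ Subgroup.centralizer ({rep i} : Set 𝒢.Adelic) ≤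
      Subgroup.centralizer ({rep i} : Set 𝒢.Adelic) := fun i => inf_le_right
  haveI : ∀ i, (count : Measure ↥(𝒢.quotientSubgroup ⊓ Subgroup.centralizer ({rep i} : Set 𝒢.Adelic))).IsHaarMeasure :=
    fun i => 𝒢.isHaarMeasure_count_inf _
  haveI : ∀ i, Countable ↥(𝒢.quotientSubgroup ⊓ Subgroup.centralizer ({rep i} : Set 𝒢.Adelic)) := fun i => by
    refine Function.Injective.countable (f := fun x : ↥(𝒢.quotientSubgroup ⊓ Subgroup.centralizer ({rep i} : Set 𝒢.Adelic)) =>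
      (⟨(x : 𝒢.Adelic), (Subgroup.mem_inf.1 x.2).1⟩ : 𝒢.quotientSubgroup)) ?_
    intro a b hab
    exact Subtype.ext (congrArg (fun y : 𝒢.quotientSubgroup => (y : 𝒢.Adelic)) hab)
  haveI : ∀ i, Countable ↥((𝒢.quotientSubgroup ⊓ Subgroup.centralizer ({rep i} : Set 𝒢.Adelic)).subgroupOf
      (Subgroup.centralizer ({rep i} : Set 𝒢.Adelic))) := fun i => by
    refine Function.Injective.countable (f := fun x : ↥((𝒢.quotientSubgroup ⊓
      Subgroup.centralizer ({rep i} : Set 𝒢.Adelic)).subgroupOf (Subgroup.centralizer ({rep i} : Set 𝒢.Adelic))) =>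
      (⟨((x : Subgroup.centralizer ({rep i} : Set 𝒢.Adelic)) : 𝒢.Adelic),
        (Subgroup.mem_inf.1 (Subgroup.mem_subgroupOf.1 x.2)).1⟩ : 𝒢.quotientSubgroup)) ?_
    intro a b hab
    exact Subtype.ext (Subtype.ext (congrArg (fun y : 𝒢.quotientSubgroup => (y : 𝒢.Adelic)) hab))
  haveI : ∀ i, LocallyCompactSpace ↥(Subgroup.centralizer ({rep i} : Set 𝒢.Adelic)) := fun i =>
    (hCcl (rep i)).isClosedEmbedding_subtypeVal.locallyCompactSpace
  haveI : ∀ i, IsClosed (((𝒢.quotientSubgroup ⊓ Subgroup.centralizer ({rep i} : Set 𝒢.Adelic)) : Subgroup 𝒢.Adelic) :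
      Set 𝒢.Adelic) := fun i => hH.inter (hCcl _)
  haveI : ∀ i, SFinite (νC i) := fun i => inferInstance
  haveI : ∀ i, CompactSpace (↥(Subgroup.centralizer ({rep i} : Set 𝒢.Adelic)) ⧸ (𝒢.quotientSubgroup ⊓
      Subgroup.centralizer ({rep i} : Set 𝒢.Adelic)).subgroupOf (Subgroup.centralizer ({rep i} : Set 𝒢.Adelic))) :=
    fun i => 𝒢.compactSpace_centralizer_quotient hdisc (hmem i)
  have hρH : ∀ i, (count : Measure ↥(𝒢.quotientSubgroup ⊓ Subgroup.centralizer ({rep i} : Set 𝒢.Adelic))) =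
      (count : Measure 𝒢.quotientSubgroup).comap (Subgroup.inclusion inf_le_left) := fun i =>
    (comap_count_eq_count (Subgroup.inclusion_injective inf_le_left)).symm
  have hρF : ∀ i, (count : Measure ↥((𝒢.quotientSubgroup ⊓ Subgroup.centralizer ({rep i} : Set 𝒢.Adelic)).subgroupOf
      (Subgroup.centralizer ({rep i} : Set 𝒢.Adelic)))) =
      Measure.map (Subgroup.subgroupOfEquivOfLe (hΓsub i)).symm
        (count : Measure ↥(𝒢.quotientSubgroup ⊓ Subgroup.centralizer ({rep i} : Set 𝒢.Adelic))) := fun i =>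
    (map_count_eq_count (Subgroup.subgroupOfEquivOfLe (hΓsub i)).symm.toEquiv
      (continuous_subgroupOfEquivOfLe_symm _ _ (hΓsub i)).measurable).symm
  -- representatives indexed by the classes of `G(K)` themselves, along `e`
  have hrep' : ∀ c : ConjClasses 𝒢.arithmeticSubgroup,
      ConjClasses.mk (⟨rep (e.symm c), hmem (e.symm c)⟩ : 𝒢.arithmeticSubgroup) = c := fun c => by
    rw [hrep, Equiv.apply_symm_apply]
  -- the `[0, ∞]`-valued identity with the printed constants
  have hId : ∀ F : 𝒢.Adelic → ℝ≥0∞, Measurable F →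
      ∫⁻ x, conjTsum 𝒢.quotientSubgroup (𝒢.arithmeticSubgroup : Set 𝒢.Adelic) (conj_mem_arithmeticSubgroup 𝒢) F x ∂μ =
        ∑' c : ConjClasses 𝒢.arithmeticSubgroup,
          ((unfoldingConstant 𝒢.quotientSubgroup (count : Measure 𝒢.quotientSubgroup) μ ν : ℝ≥0∞) *
            quotientMeasure ((𝒢.quotientSubgroup ⊓ Subgroup.centralizer ({rep (e.symm c)} : Set 𝒢.Adelic)).subgroupOf
              (Subgroup.centralizer ({rep (e.symm c)} : Set 𝒢.Adelic))) count (isClosed_subgroupOf _ _ (hH.inter (hCcl _)))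
              (νC (e.symm c)) Set.univ) *
          ∫⁻ y, descConj (rep (e.symm c)) (Subgroup.centralizer ({rep (e.symm c)} : Set 𝒢.Adelic))
            (fun _ hg => Subgroup.mem_centralizer_singleton_iff.1 hg) F y
            ∂(quotientMeasure (Subgroup.centralizer ({rep (e.symm c)} : Set 𝒢.Adelic)) (νC (e.symm c)) (hCcl _) ν) := by
    intro F hF
    have key := Literature.MeasureTheory.Group.lintegral_conjTsum_eq_mul_tsum_covol_mul
      𝒢.arithmeticSubgroup 𝒢.quotientSubgroup 𝒢.arithmeticSubgroup_le_quotientSubgroup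
      (exists_inv_mul_mem_centralizer_quotientSubgroup 𝒢)
      (fun c => (⟨rep (e.symm c), hmem (e.symm c)⟩ : 𝒢.arithmeticSubgroup)) hrep'
      (fun c => 𝒢.quotientSubgroup ⊓ Subgroup.centralizer ({rep (e.symm c)} : Set 𝒢.Adelic))
      (fun c => Subgroup.centralizer ({rep (e.symm c)} : Set 𝒢.Adelic))
      (fun c g => mem_inf_centralizer_singleton_iff _ _ _) (fun c => hΓsub (e.symm c))
      (fun c => fun _ hg => Subgroup.mem_centralizer_singleton_iff.1 hg) μ ν (count : Measure 𝒢.quotientSubgroup)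
      (fun c => (count : Measure ↥(𝒢.quotientSubgroup ⊓ Subgroup.centralizer ({rep (e.symm c)} : Set 𝒢.Adelic))))
      (fun c => (count : Measure ↥((𝒢.quotientSubgroup ⊓ Subgroup.centralizer ({rep (e.symm c)} : Set 𝒢.Adelic)).subgroupOf
        (Subgroup.centralizer ({rep (e.symm c)} : Set 𝒢.Adelic)))))
      (fun c => νC (e.symm c))
      (fun c => isOpen_subgroupOf_quotientSubgroup_of_center'_le 𝒢 hdisc 1 hθc hθA hθa hθγ
        (center'_le_inf_centralizer 𝒢 _))
      (IsAutomorphicMeasure.ne_zero 𝒢 μ) (fun c => hρH (e.symm c)) (fun c => hρF (e.symm c)) hF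
    refine Eq.trans key ?_
    rw [← ENNReal.tsum_mul_left]
    exact tsum_congr fun c => by rw [mul_assoc]
  -- positivity of the constants
  have hρ0 : (count : Measure 𝒢.quotientSubgroup) ≠ 0 := fun h => by
    have h2 : 0 < (count : Measure 𝒢.quotientSubgroup) Set.univ := isOpen_univ.measure_pos count ⟨1, trivial⟩
    rw [h] at h2
    exact lt_irrefl _ h2
  have hc0 : 0 < unfoldingConstant 𝒢.quotientSubgroup (count : Measure 𝒢.quotientSubgroup) μ ν :=
    unfoldingConstant_pos 𝒢.quotientSubgroup count μ ν (IsAutomorphicMeasure.ne_zero 𝒢 μ) hρ0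
  have hcov : ∀ i, quotientMeasure ((𝒢.quotientSubgroup ⊓ Subgroup.centralizer ({rep i} : Set 𝒢.Adelic)).subgroupOf
        (Subgroup.centralizer ({rep i} : Set 𝒢.Adelic))) count (isClosed_subgroupOf _ _ (hH.inter (hCcl _))) (νC i)
        Set.univ ≠ 0 := fun i =>
    Measure.measure_univ_ne_zero.2 (quotientMeasure_ne_zero _ _ _ (νC i))
  have hd0 : ∀ c : ConjClasses 𝒢.arithmeticSubgroup,
      ((unfoldingConstant 𝒢.quotientSubgroup (count : Measure 𝒢.quotientSubgroup) μ ν : ℝ≥0∞) *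
        quotientMeasure ((𝒢.quotientSubgroup ⊓ Subgroup.centralizer ({rep (e.symm c)} : Set 𝒢.Adelic)).subgroupOf
          (Subgroup.centralizer ({rep (e.symm c)} : Set 𝒢.Adelic))) count (isClosed_subgroupOf _ _ (hH.inter (hCcl _)))
          (νC (e.symm c)) Set.univ) ≠ 0 := fun c =>
    mul_ne_zero (ENNReal.coe_ne_zero.2 hc0.ne') (hcov (e.symm c))
  -- passage to `ℂ`
  obtain ⟨hInt, hSum, hEq⟩ := integral_quotientKernel_diag_eq_mul_tsum 𝒢 hdisc 1 hθc hθA hθa hθγ α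
    (count : Measure 𝒢.quotientSubgroup) hκ (fun c => (⟨rep (e.symm c), hmem (e.symm c)⟩ : 𝒢.arithmeticSubgroup))
    (fun c => Subgroup.centralizer ({rep (e.symm c)} : Set 𝒢.Adelic))
    (fun c => fun _ hg => Subgroup.mem_centralizer_singleton_iff.1 hg) μ
    (fun c => quotientMeasure (Subgroup.centralizer ({rep (e.symm c)} : Set 𝒢.Adelic)) (νC (e.symm c)) (hCcl _) ν) hρ0 hd0
    hId Φ
  simp only [hΦA] at hInt hSum hEq
  have htoReal : ∀ i, (((unfoldingConstant 𝒢.quotientSubgroup (count : Measure 𝒢.quotientSubgroup) μ ν : ℝ≥0∞) *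
      quotientMeasure ((𝒢.quotientSubgroup ⊓ Subgroup.centralizer ({rep i} : Set 𝒢.Adelic)).subgroupOf
        (Subgroup.centralizer ({rep i} : Set 𝒢.Adelic))) count (isClosed_subgroupOf _ _ (hH.inter (hCcl _))) (νC i)
        Set.univ)).toReal =
      (unfoldingConstant 𝒢.quotientSubgroup (count : Measure 𝒢.quotientSubgroup) μ ν : ℝ) *
        (quotientMeasure ((𝒢.quotientSubgroup ⊓ Subgroup.centralizer ({rep i} : Set 𝒢.Adelic)).subgroupOf
          (Subgroup.centralizer ({rep i} : Set 𝒢.Adelic))) count (isClosed_subgroupOf _ _ (hH.inter (hCcl _))) (νC i)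
          Set.univ).toReal := fun i => by
    rw [ENNReal.toReal_mul, ENNReal.coe_toReal]
  refine ⟨fun i => ?_, ?_, ?_⟩
  · obtain ⟨c, rfl⟩ := e.symm.surjective i
    exact hInt c
  · simp only [htoReal, mul_assoc] at hSum
    have hSum' := (summable_mul_left_iff (NNReal.coe_pos.2 hc0).ne').1 hSum
    rw [← e.symm.summable_iff]
    exact hSum'
  · rw [hEq, NNReal.coe_one, Complex.ofReal_one, one_mul, ← tsum_mul_left]
    conv_rhs => rw [← e.symm.tsum_eq]
    refine tsum_congr fun c => ?_
    rw [htoReal, Complex.ofReal_mul, mul_assoc]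

/-- **The covolumes are positive and finite**: `vol(G(K)_γ \ G_γ) ∈ (0, ∞)` for every rational `γ` (datum with discrete `G(K)` and
compact automorphic quotient: `G_γ ⧸ G(K)_γ` is compact, ★ `compactSpace_centralizer_quotient`, and the quotient measure is a
non-zero Radon measure). [cite: Gelbart1975, Remark 9.23] -/
theorem covol_ne_zero_ne_top (hdisc : 𝒢.IsDiscreteRational) [CompactSpace 𝒢.automorphicQuotient]
    [hH : IsClosed (𝒢.quotientSubgroup : Set 𝒢.Adelic)]
    [hCcl : ∀ γ : 𝒢.Adelic, IsClosed ((Subgroup.centralizer ({γ} : Set 𝒢.Adelic) : Subgroup 𝒢.Adelic) : Set 𝒢.Adelic)]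
    [∀ γ : 𝒢.Adelic, MeasurableSpace (↥(Subgroup.centralizer ({γ} : Set 𝒢.Adelic)) ⧸
      (𝒢.quotientSubgroup ⊓ Subgroup.centralizer ({γ} : Set 𝒢.Adelic)).subgroupOf (Subgroup.centralizer ({γ} : Set 𝒢.Adelic)))]
    [∀ γ : 𝒢.Adelic, BorelSpace (↥(Subgroup.centralizer ({γ} : Set 𝒢.Adelic)) ⧸
      (𝒢.quotientSubgroup ⊓ Subgroup.centralizer ({γ} : Set 𝒢.Adelic)).subgroupOf (Subgroup.centralizer ({γ} : Set 𝒢.Adelic)))]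
    [∀ γ : 𝒢.Adelic, (count : Measure ↥((𝒢.quotientSubgroup ⊓ Subgroup.centralizer ({γ} : Set 𝒢.Adelic)).subgroupOf
      (Subgroup.centralizer ({γ} : Set 𝒢.Adelic)))).IsHaarMeasure]
    {γ : 𝒢.Adelic} (hγ : γ ∈ 𝒢.arithmeticSubgroup)
    (νZ : Measure ↥(Subgroup.centralizer ({γ} : Set 𝒢.Adelic))) [IsHaarMeasure νZ] [νZ.IsMulRightInvariant] :
    quotientMeasure ((𝒢.quotientSubgroup ⊓ Subgroup.centralizer ({γ} : Set 𝒢.Adelic)).subgroupOf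
        (Subgroup.centralizer ({γ} : Set 𝒢.Adelic))) count (isClosed_subgroupOf _ _ (hH.inter (hCcl _))) νZ Set.univ ≠ 0 ∧
      quotientMeasure ((𝒢.quotientSubgroup ⊓ Subgroup.centralizer ({γ} : Set 𝒢.Adelic)).subgroupOf
        (Subgroup.centralizer ({γ} : Set 𝒢.Adelic))) count (isClosed_subgroupOf _ _ (hH.inter (hCcl _))) νZ Set.univ ≠ ∞ := by
  haveI := 𝒢.compactSpace_centralizer_quotient hdisc hγ
  exact ⟨Measure.measure_univ_ne_zero.2 (quotientMeasure_ne_zero _ _ _ νZ),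
    (isCompact_univ.measure_lt_top (μ := quotientMeasure ((𝒢.quotientSubgroup ⊓
      Subgroup.centralizer ({γ} : Set 𝒢.Adelic)).subgroupOf (Subgroup.centralizer ({γ} : Set 𝒢.Adelic))) count
      (isClosed_subgroupOf _ _ (hH.inter (hCcl _))) νZ)).ne⟩

/-- **`θ(Φ) = Σ'_i vol(G(K)_i \ G_i) · O_i(Φ)` — the diagonal trace functional with the printed volumes and NO constant**
(datum with `A_G = ⊥`, discrete `G(K)`, compact quotient; `θ = 𝒢.diagTrace μ count ν = c_μ⁻¹ ∫_X K_Φ(x, x) dμ`, ★ `diagTrace_apply`):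
the factor `c_μ` of `integral_quotientKernel_diag_eq_mul_tsum_covol_mul_of_center'_eq_bot` cancels against `c_μ⁻¹`.  Gelbart's
(9.13) `tr R(f) = Σ_{[γ]} vol(Γ(γ)\G(γ)) ∫_{G(γ)\G} f(x⁻¹ γ x) dx`, read for the functional `θ` of the tree.
[cite: Gelbart1975, (9.13) and Remark 9.23] -/
theorem diagTrace_eq_tsum_covol_mul_of_center'_eq_bot (hc : 𝒢.center' = ⊥)
    (hdisc : 𝒢.IsDiscreteRational) [CompactSpace 𝒢.automorphicQuotient]
    [hH : IsClosed (𝒢.quotientSubgroup : Set 𝒢.Adelic)]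
    [hCcl : ∀ γ : 𝒢.Adelic, IsClosed ((Subgroup.centralizer ({γ} : Set 𝒢.Adelic) : Subgroup 𝒢.Adelic) : Set 𝒢.Adelic)]
    [IsFiniteMeasureOnCompacts (count : Measure 𝒢.quotientSubgroup)] [SFinite (count : Measure 𝒢.quotientSubgroup)]
    [∀ γ : 𝒢.Adelic, MeasurableSpace (𝒢.Adelic ⧸ Subgroup.centralizer ({γ} : Set 𝒢.Adelic))]
    [∀ γ : 𝒢.Adelic, BorelSpace (𝒢.Adelic ⧸ Subgroup.centralizer ({γ} : Set 𝒢.Adelic))]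
    [∀ γ : 𝒢.Adelic, MeasurableSpace (↥(Subgroup.centralizer ({γ} : Set 𝒢.Adelic)) ⧸
      (𝒢.quotientSubgroup ⊓ Subgroup.centralizer ({γ} : Set 𝒢.Adelic)).subgroupOf (Subgroup.centralizer ({γ} : Set 𝒢.Adelic)))]
    [∀ γ : 𝒢.Adelic, BorelSpace (↥(Subgroup.centralizer ({γ} : Set 𝒢.Adelic)) ⧸
      (𝒢.quotientSubgroup ⊓ Subgroup.centralizer ({γ} : Set 𝒢.Adelic)).subgroupOf (Subgroup.centralizer ({γ} : Set 𝒢.Adelic)))]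
    [∀ γ : 𝒢.Adelic, (count : Measure ↥((𝒢.quotientSubgroup ⊓ Subgroup.centralizer ({γ} : Set 𝒢.Adelic)).subgroupOf
      (Subgroup.centralizer ({γ} : Set 𝒢.Adelic)))).IsHaarMeasure]
    (μ : Measure 𝒢.automorphicQuotient) [𝒢.IsAutomorphicMeasure μ]
    (ν : Measure 𝒢.Adelic) [IsHaarMeasure ν] [ν.IsMulRightInvariant]
    {I : Type*} (e : I ≃ ConjClasses 𝒢.arithmeticSubgroup) (rep : I → 𝒢.Adelic) (hmem : ∀ i, rep i ∈ 𝒢.arithmeticSubgroup)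
    (hrep : ∀ i, ConjClasses.mk (⟨rep i, hmem i⟩ : 𝒢.arithmeticSubgroup) = e i)
    (νC : ∀ i, Measure ↥(Subgroup.centralizer ({rep i} : Set 𝒢.Adelic))) [∀ i, IsHaarMeasure (νC i)]
    [∀ i, (νC i).IsMulRightInvariant] [∀ i, (νC i).IsInvInvariant] (Φ : C_c(𝒢.Adelic, ℂ)) :
    𝒢.diagTrace μ (count : Measure 𝒢.quotientSubgroup) ν Φ =
      ∑' i, (((quotientMeasure ((𝒢.quotientSubgroup ⊓ Subgroup.centralizer ({rep i} : Set 𝒢.Adelic)).subgroupOf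
          (Subgroup.centralizer ({rep i} : Set 𝒢.Adelic))) count (isClosed_subgroupOf _ _ (hH.inter (hCcl _))) (νC i)
          Set.univ).toReal : ℝ) : ℂ) *
        ∫ y, descConj (rep i) (Subgroup.centralizer ({rep i} : Set 𝒢.Adelic))
          (fun _ hg => Subgroup.mem_centralizer_singleton_iff.1 hg) Φ y
          ∂(quotientMeasure (Subgroup.centralizer ({rep i} : Set 𝒢.Adelic)) (νC i) (hCcl _) ν) := by
  obtain ⟨-, -, hEq⟩ := 𝒢.integral_quotientKernel_diag_eq_mul_tsum_covol_mul_of_center'_eq_bot hc hdisc μ ν e rep hmem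
    hrep νC Φ
  have hc0 : 0 < unfoldingConstant 𝒢.quotientSubgroup (count : Measure 𝒢.quotientSubgroup) μ ν := by
    haveI : DiscreteTopology 𝒢.quotientSubgroup := 𝒢.discreteTopology_quotientSubgroup' hc hdisc
    have hρ0 : (count : Measure 𝒢.quotientSubgroup) ≠ 0 := fun h => by
      have h2 : 0 < (count : Measure 𝒢.quotientSubgroup) Set.univ := isOpen_univ.measure_pos count ⟨1, trivial⟩
      rw [h] at h2
      exact lt_irrefl _ h2
    exact unfoldingConstant_pos 𝒢.quotientSubgroup count μ ν (IsAutomorphicMeasure.ne_zero 𝒢 μ) hρ0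
  have hne : ((unfoldingConstant 𝒢.quotientSubgroup (count : Measure 𝒢.quotientSubgroup) μ ν : ℝ) : ℂ) ≠ 0 :=
    Complex.ofReal_ne_zero.2 (NNReal.coe_pos.2 hc0).ne'
  rw [diagTrace_apply, hEq, ← mul_assoc, inv_mul_cancel₀ hne, one_mul]

end AdelicGroupData

/-! ## §2 The unitary group of an anisotropic hermitian matrix over a CM field: the binders are dischargeable -/

namespace UnitaryGroup

open Literature.NumberTheory.Rogawski1990
open Literature.AlgebraicGeometry.ShimuraVarieties (hermForm)

variable (L : Type) [Field L] [NumberField L] [IsCMField L] (N : ℕ) (H : Matrix (Fin N) (Fin N) L)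

/-- The bijection of conjugacy classes `[γ] ↦ [toAdelic γ]` from the rational group `U(H)(L⁺)` to its diagonal image in `U(H)(𝔸)`,
with the representatives `toAdelic (out [γ])` in the required position (★ `bijective_conjClassesMap_of_mulEquiv` along
`MonoidHom.ofInjective (cmDatum_toAdelic_injective)`). [cite: Rogawski1990, §14.5 p. 237] -/
theorem exists_conjClasses_equiv_toAdelic_out :
    ∃ e : ConjClasses (cmDatum L N H).Rational ≃ ConjClasses (cmDatum L N H).arithmeticSubgroup,
      (∀ γ : (cmDatum L N H).Rational, e (ConjClasses.mk γ) = ConjClasses.mk ⟨(cmDatum L N H).toAdelic γ, ⟨γ, rfl⟩⟩) ∧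
      ∀ c : ConjClasses (cmDatum L N H).Rational,
        ConjClasses.mk (⟨(cmDatum L N H).toAdelic (Quotient.out c), ⟨Quotient.out c, rfl⟩⟩ : (cmDatum L N H).arithmeticSubgroup) =
          e c := by
  classical
  obtain ⟨ι, hι⟩ : ∃ ι : (cmDatum L N H).Rational ≃* (cmDatum L N H).arithmeticSubgroup,
      ∀ γ, ((ι γ : (cmDatum L N H).arithmeticSubgroup) : (cmDatum L N H).Adelic) = (cmDatum L N H).toAdelic γ :=
    ⟨MonoidHom.ofInjective (cmDatum_toAdelic_injective L N H), fun _ => rfl⟩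
  have hbij := Literature.NumberTheory.Rogawski1990.bijective_conjClassesMap_of_mulEquiv ι
  have he : ∀ γ : (cmDatum L N H).Rational, Equiv.ofBijective _ hbij (ConjClasses.mk γ) =
      ConjClasses.mk ⟨(cmDatum L N H).toAdelic γ, ⟨γ, rfl⟩⟩ := fun γ => by
    show ConjClasses.mk (ι.toMonoidHom γ) = _
    exact congrArg ConjClasses.mk (Subtype.ext (hι γ))
  refine ⟨Equiv.ofBijective _ hbij, he, fun c => ?_⟩
  conv_rhs => rw [← Quotient.out_eq c, ConjClasses.quotient_mk_eq_mk]
  exact (he (Quotient.out c)).symm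

variable [MeasurableSpace (cmDatum L N H).Adelic] [BorelSpace (cmDatum L N H).Adelic]

/-- **Every Haar measure on the adelic centraliser `U(H)(𝔸)_γ` of a rational `γ ∈ U(H)(L⁺)` is inversion invariant** (`H`
anisotropic): it is two-sided (★ `isMulRightInvariant_centralizer_cmDatum`, Deitmar–Echterhoff Lemma 9.3.3: `G_γ` carries the
uniform lattice `G(K)_γ`), hence inversion invariant (★ `isInvInvariant_of_isMulRightInvariant`).  Discharges the binder
`[(νZ c).IsInvInvariant]` of §3. [cite: DeitmarEchterhoff2014, Lemma 9.3.3] -/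
theorem isInvInvariant_centralizer_cmDatum
    (hanis : ∀ x : Fin N → L, hermForm (cmConjRingHom L) H x x = 0 → x = 0)
    {γ : (cmDatum L N H).Adelic} (hγ : γ ∈ (cmDatum L N H).arithmeticSubgroup)
    (νZ : Measure ↥(Subgroup.centralizer ({γ} : Set (cmDatum L N H).Adelic))) [IsHaarMeasure νZ] : νZ.IsInvInvariant := by
  haveI : IsClosed ((Subgroup.centralizer ({γ} : Set (cmDatum L N H).Adelic) : Subgroup (cmDatum L N H).Adelic) :
      Set (cmDatum L N H).Adelic) := Set.isClosed_centralizer _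
  haveI := isMulRightInvariant_centralizer_cmDatum L N H hanis hγ νZ
  exact isInvInvariant_of_isMulRightInvariant νZ

/-- **The counting measure is a Haar measure on `U(H)(L⁺)_γ = U(H)(L⁺) ∩ U(H)(𝔸)_γ`** (inside the centraliser `U(H)(𝔸)_γ`), for
every `γ ∈ U(H)(𝔸)`: `U(H)(L⁺)` is discrete and countable (★ `discreteTopology_cmDatum_quotientSubgroup`,
★ `countable_cmDatum_quotientSubgroup`).  Discharges the binder on `count` of §3; this is the measure on `G(K)_γ` implicit in the
printed `m(G′_γ \ G′_γ(𝔸))` (counting measure on the discrete group of rational points). [cite: Rogawski1990, §14.5 p. 238] -/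
theorem isHaarMeasure_count_inf_centralizer_subgroupOf_cmDatum (γ : (cmDatum L N H).Adelic) :
    (count : Measure ↥(((cmDatum L N H).quotientSubgroup ⊓ Subgroup.centralizer ({γ} : Set (cmDatum L N H).Adelic)).subgroupOf
      (Subgroup.centralizer ({γ} : Set (cmDatum L N H).Adelic)))).IsHaarMeasure := by
  haveI := discreteTopology_cmDatum_quotientSubgroup L N H
  haveI := countable_cmDatum_quotientSubgroup L N H
  exact (cmDatum L N H).isHaarMeasure_count_inf_subgroupOf _

/-! ## §3 `θ_{G′}(F) = Σ_{[γ]} vol(U(H)(L⁺)_γ \ U(H)(𝔸)_γ) · Φ_{ν/ν_γ}(γ, F)` — the orbital weights are covolumes -/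

variable
  [∀ γ : (cmDatum L N H).Adelic,
    MeasurableSpace ((cmDatum L N H).Adelic ⧸ Subgroup.centralizer ({γ} : Set (cmDatum L N H).Adelic))]
  [∀ γ : (cmDatum L N H).Adelic,
    BorelSpace ((cmDatum L N H).Adelic ⧸ Subgroup.centralizer ({γ} : Set (cmDatum L N H).Adelic))]
  [∀ γ : (cmDatum L N H).Adelic, MeasurableSpace (↥(Subgroup.centralizer ({γ} : Set (cmDatum L N H).Adelic)) ⧸
    ((cmDatum L N H).quotientSubgroup ⊓ Subgroup.centralizer ({γ} : Set (cmDatum L N H).Adelic)).subgroupOf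
      (Subgroup.centralizer ({γ} : Set (cmDatum L N H).Adelic)))]
  [∀ γ : (cmDatum L N H).Adelic, BorelSpace (↥(Subgroup.centralizer ({γ} : Set (cmDatum L N H).Adelic)) ⧸
    ((cmDatum L N H).quotientSubgroup ⊓ Subgroup.centralizer ({γ} : Set (cmDatum L N H).Adelic)).subgroupOf
      (Subgroup.centralizer ({γ} : Set (cmDatum L N H).Adelic)))]
  [hCcl : ∀ γ : (cmDatum L N H).Adelic, IsClosed ((Subgroup.centralizer ({γ} : Set (cmDatum L N H).Adelic) :
    Subgroup (cmDatum L N H).Adelic) : Set (cmDatum L N H).Adelic)]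
  [∀ γ : (cmDatum L N H).Adelic, (count : Measure ↥(((cmDatum L N H).quotientSubgroup ⊓
    Subgroup.centralizer ({γ} : Set (cmDatum L N H).Adelic)).subgroupOf
      (Subgroup.centralizer ({γ} : Set (cmDatum L N H).Adelic)))).IsHaarMeasure]
  (μ : Measure (cmDatum L N H).automorphicQuotient) [(cmDatum L N H).IsAutomorphicMeasure μ]
  (ν : Measure (cmDatum L N H).Adelic) [ν.IsHaarMeasure] [ν.IsMulRightInvariant]
  (νZ : ∀ c : ConjClasses (cmDatum L N H).Rational,
    Measure ↥(Subgroup.centralizer ({(cmDatum L N H).toAdelic (Quotient.out c)} : Set (cmDatum L N H).Adelic)))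
  [∀ c, IsHaarMeasure (νZ c)] [∀ c, (νZ c).IsMulRightInvariant] [∀ c, (νZ c).IsInvInvariant]

/-- **The trace functional of the anisotropic inner form with the printed volumes** (Rogawski (1990), §14.5 pp. 237–238 (print):
`J_{G′}(f′) = Σ_γ a_γ Φ(γ, f′)` over the conjugacy classes of `G′(F)`, `a_γ` a covolume; Gelbart (1975), Remark 9.23).  For `H`
anisotropic, `μ` automorphic, `ν` a Haar measure on `U(H)(𝔸_{L⁺})` (two-sided, ★ `isMulRightInvariant_cmDatum`) and, for every
conjugacy class `[γ]` of the RATIONAL group `U(H)(L⁺)` with representative `γ = out [γ]`, a Haar measure `ν_γ` on the adelic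
centraliser `U(H)(𝔸)_γ = C(toAdelic γ)` (two-sided and inversion invariant, §2): for every `F ∈ C_c(U(H)(𝔸_{L⁺}))` the orbital
integrands are integrable for `ν/ν_γ`, `Σ_{[γ]} vol_γ ∫ |F(y γ y⁻¹)| d(ν/ν_γ) < ∞`, and

  `UnitaryGroup.diagTrace L N H μ ν hanis F = Σ'_{[γ]} vol(U(H)(L⁺)_γ \ U(H)(𝔸)_γ) · Φ_{ν/ν_γ}(γ, F)`,

`Φ_{ν/ν_γ}(γ, F) = adelicOrbitalIntegral L N H γ F (ν/ν_γ) = ∫_{U(H)(𝔸) ⧸ U(H)(𝔸)_γ} F(y γ y⁻¹) d(ν/ν_γ)(y)` (quotient measure with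
Weil constant one) and `vol(U(H)(L⁺)_γ \ U(H)(𝔸)_γ) = quotientMeasure (U(H)(L⁺)_γ ≤ U(H)(𝔸)_γ) count ν_γ (univ)`, the covolume of
the discrete `U(H)(L⁺)_γ` (counting measure) in `U(H)(𝔸)_γ` (measure `ν_γ`) — NO unspecified constant
(`AdelicGroupData.integral_quotientKernel_diag_eq_mul_tsum_covol_mul_of_center'_eq_bot` ∕ `…diagTrace_eq_tsum_covol_mul…` for
`cmDatum L N H` along `exists_conjClasses_equiv_toAdelic_out`). [cite: Rogawski1990, §14.5 pp. 237–238] -/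
theorem diagTrace_eq_tsum_covol_mul_orbitalIntegral
    (hanis : ∀ x : Fin N → L, hermForm (cmConjRingHom L) H x x = 0 → x = 0) (F : C_c((cmDatum L N H).Adelic, ℂ)) :
    (∀ c : ConjClasses (cmDatum L N H).Rational, Integrable (descConj ((cmDatum L N H).toAdelic (Quotient.out c))
        (Subgroup.centralizer ({(cmDatum L N H).toAdelic (Quotient.out c)} : Set (cmDatum L N H).Adelic))
        (fun _ hg => Subgroup.mem_centralizer_singleton_iff.1 hg) F)
        (quotientMeasure (Subgroup.centralizer ({(cmDatum L N H).toAdelic (Quotient.out c)} : Set (cmDatum L N H).Adelic))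
          (νZ c) (hCcl _) ν)) ∧
    Summable (fun c : ConjClasses (cmDatum L N H).Rational =>
      (quotientMeasure (((cmDatum L N H).quotientSubgroup ⊓
          Subgroup.centralizer ({(cmDatum L N H).toAdelic (Quotient.out c)} : Set (cmDatum L N H).Adelic)).subgroupOf
          (Subgroup.centralizer ({(cmDatum L N H).toAdelic (Quotient.out c)} : Set (cmDatum L N H).Adelic))) count
          (isClosed_subgroupOf _ _ ((isClosed_cmDatum_quotientSubgroup L N H).inter (hCcl _))) (νZ c) Set.univ).toReal *
        ∫ y, ‖descConj ((cmDatum L N H).toAdelic (Quotient.out c))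
          (Subgroup.centralizer ({(cmDatum L N H).toAdelic (Quotient.out c)} : Set (cmDatum L N H).Adelic))
          (fun _ hg => Subgroup.mem_centralizer_singleton_iff.1 hg) F y‖
          ∂(quotientMeasure (Subgroup.centralizer ({(cmDatum L N H).toAdelic (Quotient.out c)} :
            Set (cmDatum L N H).Adelic)) (νZ c) (hCcl _) ν)) ∧
    diagTrace L N H μ ν hanis F =
      ∑' c : ConjClasses (cmDatum L N H).Rational,
        (((quotientMeasure (((cmDatum L N H).quotientSubgroup ⊓
            Subgroup.centralizer ({(cmDatum L N H).toAdelic (Quotient.out c)} : Set (cmDatum L N H).Adelic)).subgroupOf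
            (Subgroup.centralizer ({(cmDatum L N H).toAdelic (Quotient.out c)} : Set (cmDatum L N H).Adelic))) count
            (isClosed_subgroupOf _ _ ((isClosed_cmDatum_quotientSubgroup L N H).inter (hCcl _))) (νZ c) Set.univ).toReal :
            ℝ) : ℂ) *
          adelicOrbitalIntegral L N H (Quotient.out c) F
            (quotientMeasure (Subgroup.centralizer ({(cmDatum L N H).toAdelic (Quotient.out c)} :
              Set (cmDatum L N H).Adelic)) (νZ c) (hCcl _) ν) := by
  haveI := compactSpace_cmDatum_automorphicQuotient L N H hanis
  haveI := isClosed_cmDatum_quotientSubgroup L N H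
  haveI := countable_cmDatum_quotientSubgroup L N H
  haveI := isFiniteMeasureOnCompacts_count_cmDatum_quotientSubgroup L N H
  obtain ⟨e, -, he⟩ := exists_conjClasses_equiv_toAdelic_out L N H
  obtain ⟨hInt, hSum, -⟩ := (cmDatum L N H).integral_quotientKernel_diag_eq_mul_tsum_covol_mul_of_center'_eq_bot
    (cmDatum_center' L N H) (cmDatum_isDiscreteRational L N H) μ ν e
    (fun c => (cmDatum L N H).toAdelic (Quotient.out c)) (fun c => ⟨Quotient.out c, rfl⟩) he νZ F
  have hθ := (cmDatum L N H).diagTrace_eq_tsum_covol_mul_of_center'_eq_bot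
    (cmDatum_center' L N H) (cmDatum_isDiscreteRational L N H) μ ν e
    (fun c => (cmDatum L N H).toAdelic (Quotient.out c)) (fun c => ⟨Quotient.out c, rfl⟩) he νZ F
  refine ⟨hInt, hSum, ?_⟩
  rw [diagTrace_eq]
  exact hθ

omit [∀ γ : (cmDatum L N H).Adelic,
    MeasurableSpace ((cmDatum L N H).Adelic ⧸ Subgroup.centralizer ({γ} : Set (cmDatum L N H).Adelic))]
  [∀ γ : (cmDatum L N H).Adelic,
    BorelSpace ((cmDatum L N H).Adelic ⧸ Subgroup.centralizer ({γ} : Set (cmDatum L N H).Adelic))]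
  [∀ c, (νZ c).IsInvInvariant] in
/-- **The covolumes `vol(U(H)(L⁺)_γ \ U(H)(𝔸)_γ)` are positive real numbers** (`H` anisotropic, `γ = out [γ]` rational): the
weights of `diagTrace_eq_tsum_covol_mul_orbitalIntegral` lie in `(0, ∞)` (`U(H)(𝔸)_γ ⧸ U(H)(L⁺)_γ` compact,
★ `compactSpace_centralizer_quotient_cmDatum`). [cite: Rogawski1990, §14.5 p. 238] -/
theorem covol_toReal_pos_cmDatum
    (hanis : ∀ x : Fin N → L, hermForm (cmConjRingHom L) H x x = 0 → x = 0) (c : ConjClasses (cmDatum L N H).Rational) :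
    0 < (quotientMeasure (((cmDatum L N H).quotientSubgroup ⊓
          Subgroup.centralizer ({(cmDatum L N H).toAdelic (Quotient.out c)} : Set (cmDatum L N H).Adelic)).subgroupOf
          (Subgroup.centralizer ({(cmDatum L N H).toAdelic (Quotient.out c)} : Set (cmDatum L N H).Adelic))) count
          (isClosed_subgroupOf _ _ ((isClosed_cmDatum_quotientSubgroup L N H).inter (hCcl _))) (νZ c) Set.univ).toReal := by
  haveI := compactSpace_cmDatum_automorphicQuotient L N H hanis
  haveI := isClosed_cmDatum_quotientSubgroup L N H
  obtain ⟨h0, htop⟩ := (cmDatum L N H).covol_ne_zero_ne_top (cmDatum_isDiscreteRational L N H)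
    (γ := (cmDatum L N H).toAdelic (Quotient.out c)) ⟨Quotient.out c, rfl⟩ (νZ c)
  exact ENNReal.toReal_pos h0 htop

/-- **`θ_{G′}(F) = Σᶠ_{[γ]} vol(U(H)(L⁺)_γ \ U(H)(𝔸)_γ) · Φ_{ν/ν_γ}(γ, F)` as a FINITE sum, in the currency of
★ `adelicClassOrbitalIntegral`**: with the family `μ_{[γ]} := ν/ν_γ = quotientMeasure (U(H)(𝔸)_γ) ν_γ ν` of adelic orbital measures
(an ★ `AdelicOrbitalMeasureFamily L N H`: quotient measures with Weil constant one on `U(H)(𝔸) ⧸ U(H)(𝔸)_{γ}`, `γ = toAdelic (out [γ])`),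
the class function `[γ] ↦ vol_γ · adelicClassOrbitalIntegral L N H μ F [γ]` is finitely supported for every `F ∈ C_c(U(H)(𝔸_{L⁺}))`
(`finite_support_mul_integral_descConj`) and `diagTrace L N H μA ν hanis F` is its `finsum` — Rogawski's `Σ_γ a_γ Φ(γ, f′)` with
`a_γ` THE COVOLUME, no unspecified constant. [cite: Rogawski1990, §14.5 pp. 237–238] -/
theorem diagTrace_eq_finsum_covol_mul_adelicClassOrbitalIntegral
    (hanis : ∀ x : Fin N → L, hermForm (cmConjRingHom L) H x x = 0 → x = 0) (F : C_c((cmDatum L N H).Adelic, ℂ)) :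
    (Function.support fun c : ConjClasses (cmDatum L N H).Rational =>
      (((quotientMeasure (((cmDatum L N H).quotientSubgroup ⊓
          Subgroup.centralizer ({(cmDatum L N H).toAdelic (Quotient.out c)} : Set (cmDatum L N H).Adelic)).subgroupOf
          (Subgroup.centralizer ({(cmDatum L N H).toAdelic (Quotient.out c)} : Set (cmDatum L N H).Adelic))) count
          (isClosed_subgroupOf _ _ ((isClosed_cmDatum_quotientSubgroup L N H).inter (hCcl _))) (νZ c) Set.univ).toReal :
          ℝ) : ℂ) *
        adelicClassOrbitalIntegral L N H (fun c => quotientMeasure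
          (Subgroup.centralizer ({(cmDatum L N H).toAdelic (Quotient.out c)} : Set (cmDatum L N H).Adelic)) (νZ c) (hCcl _) ν)
          F c).Finite ∧
    diagTrace L N H μ ν hanis F =
      ∑ᶠ c : ConjClasses (cmDatum L N H).Rational,
        (((quotientMeasure (((cmDatum L N H).quotientSubgroup ⊓
            Subgroup.centralizer ({(cmDatum L N H).toAdelic (Quotient.out c)} : Set (cmDatum L N H).Adelic)).subgroupOf
            (Subgroup.centralizer ({(cmDatum L N H).toAdelic (Quotient.out c)} : Set (cmDatum L N H).Adelic))) count
            (isClosed_subgroupOf _ _ ((isClosed_cmDatum_quotientSubgroup L N H).inter (hCcl _))) (νZ c) Set.univ).toReal :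
            ℝ) : ℂ) *
          adelicClassOrbitalIntegral L N H (fun c => quotientMeasure
            (Subgroup.centralizer ({(cmDatum L N H).toAdelic (Quotient.out c)} : Set (cmDatum L N H).Adelic)) (νZ c) (hCcl _) ν)
            F c := by
  haveI := compactSpace_cmDatum_automorphicQuotient L N H hanis
  obtain ⟨e, -, he⟩ := exists_conjClasses_equiv_toAdelic_out L N H
  have hfin := (cmDatum L N H).finite_support_mul_integral_descConj (cmDatum_isDiscreteRational L N H) e
    (fun c => (cmDatum L N H).toAdelic (Quotient.out c)) (fun c => ⟨Quotient.out c, rfl⟩) he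
    (fun c => quotientMeasure (Subgroup.centralizer ({(cmDatum L N H).toAdelic (Quotient.out c)} :
      Set (cmDatum L N H).Adelic)) (νZ c) (hCcl _) ν)
    (fun c => (((quotientMeasure (((cmDatum L N H).quotientSubgroup ⊓
          Subgroup.centralizer ({(cmDatum L N H).toAdelic (Quotient.out c)} : Set (cmDatum L N H).Adelic)).subgroupOf
          (Subgroup.centralizer ({(cmDatum L N H).toAdelic (Quotient.out c)} : Set (cmDatum L N H).Adelic))) count
          (isClosed_subgroupOf _ _ ((isClosed_cmDatum_quotientSubgroup L N H).inter (hCcl _))) (νZ c) Set.univ).toReal :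
          ℝ) : ℂ)) F
  obtain ⟨-, -, hEq⟩ := diagTrace_eq_tsum_covol_mul_orbitalIntegral L N H μ ν νZ hanis F
  refine ⟨hfin, ?_⟩
  rw [hEq]
  exact tsum_eq_finsum hfin

/-- **T1a with the PRINTED weights — `θ_{G′}(F) = Σᶠ_{𝒪_st} 𝒪_st.orbitalSum ([γ] ↦ vol(U(H)(L⁺)_γ \ U(H)(𝔸)_γ) · Φ_{ν/ν_γ}(γ, F))`**
(Rogawski (1990), §14.5 pp. 237–238 (print): `J_{G′}(f′) = Σ_{𝒪_st} J(𝒪_st, f′)`, `J(𝒪_st, f′) = Σ_{γ ∈ 𝒪_st} a_γ Φ(γ, f′)` with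
the covolume weights `a_γ`): `diagTrace_eq_finsum_covol_mul_adelicClassOrbitalIntegral` regrouped by STABLE classes
(★ `finsum_stableClass_orbitalSum`).  In the currency of ★ `exists_weight_diagTrace_eq_finsum_orbitalSum_of_admissible` («for every
admissible family there are SOME weights `a > 0`»): for the family of quotient measures `ν/ν_γ` the weights CAN BE CHOSEN to be the
covolumes (positive, `covol_toReal_pos_cmDatum`) — the orbital weights of the anisotropic inner form are covolumes.
[cite: Rogawski1990, §14.5 pp. 237–238] -/
theorem diagTrace_eq_finsum_stableClass_orbitalSum_covol_mul
    (hanis : ∀ x : Fin N → L, hermForm (cmConjRingHom L) H x x = 0 → x = 0) (F : C_c((cmDatum L N H).Adelic, ℂ)) :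
    (Function.support fun st : StableClass (cmConjRingHom L) H => st.orbitalSum fun c : ConjClasses (cmDatum L N H).Rational =>
      (((quotientMeasure (((cmDatum L N H).quotientSubgroup ⊓
          Subgroup.centralizer ({(cmDatum L N H).toAdelic (Quotient.out c)} : Set (cmDatum L N H).Adelic)).subgroupOf
          (Subgroup.centralizer ({(cmDatum L N H).toAdelic (Quotient.out c)} : Set (cmDatum L N H).Adelic))) count
          (isClosed_subgroupOf _ _ ((isClosed_cmDatum_quotientSubgroup L N H).inter (hCcl _))) (νZ c) Set.univ).toReal :
          ℝ) : ℂ) *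
        adelicClassOrbitalIntegral L N H (fun c => quotientMeasure
          (Subgroup.centralizer ({(cmDatum L N H).toAdelic (Quotient.out c)} : Set (cmDatum L N H).Adelic)) (νZ c) (hCcl _) ν)
          F c).Finite ∧
    diagTrace L N H μ ν hanis F =
      ∑ᶠ st : StableClass (cmConjRingHom L) H, st.orbitalSum fun c : ConjClasses (cmDatum L N H).Rational =>
        (((quotientMeasure (((cmDatum L N H).quotientSubgroup ⊓
            Subgroup.centralizer ({(cmDatum L N H).toAdelic (Quotient.out c)} : Set (cmDatum L N H).Adelic)).subgroupOf
            (Subgroup.centralizer ({(cmDatum L N H).toAdelic (Quotient.out c)} : Set (cmDatum L N H).Adelic))) count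
            (isClosed_subgroupOf _ _ ((isClosed_cmDatum_quotientSubgroup L N H).inter (hCcl _))) (νZ c) Set.univ).toReal :
            ℝ) : ℂ) *
          adelicClassOrbitalIntegral L N H (fun c => quotientMeasure
            (Subgroup.centralizer ({(cmDatum L N H).toAdelic (Quotient.out c)} : Set (cmDatum L N H).Adelic)) (νZ c) (hCcl _) ν)
            F c := by
  obtain ⟨hfin, hEq⟩ := diagTrace_eq_finsum_covol_mul_adelicClassOrbitalIntegral L N H μ ν νZ hanis F
  refine ⟨StableClass.finite_support_orbitalSum _ hfin, ?_⟩
  rw [hEq]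
  exact (finsum_stableClass_orbitalSum _ hfin).symm

end UnitaryGroup

end Literature.NumberTheory.Automorphic
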